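import Summits.AnomalousDissipation.AnomalousDissipation.Theses.TwoAndHalfD
import Literature.Analysis.FluidPDE.PassiveScalarForced
import Literature.Analysis.FluidPDE.PassiveScalar
import Literature.Analysis.FluidPDE.TurbWave0
import Literature.Analysis.FunctionSpaces.TorusFluidGlue
import Literature.Analysis.FunctionSpaces.TorusCalculus

/-!
# Sketch — crux-ideate stmt-AnomalousDissipation-0206 (`TwoAndHalfD.TwohalfdThesis`), round 1, ideator 1

First-lemma signatures for the two idea cards of this seat (they must ELABORATE; proofs are not
required except where trivial):

* card `ergodic-minimax-collapse`: `affineBudget` (proved), `LimitWitness2halfD`,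
  `LimitWitnessLift`, `FiniteHorizonSup2halfD`, `FiniteHorizonTransfer`, `FiniteHorizonOfThesis`;
* card `autocatalytic-debris-seeding`: `planarCurl`, `VorticityIsSourcedScalar`,
  `SourcedScalarMaxPrinciple`, `TorqueAgeLaw`.
-/

noncomputable section

set_option linter.dupNamespace false

open MeasureTheory Set Filter Topology
open scoped InnerProductSpace

namespace Summit.AnomalousDissipation.AnomalousDissipation.Cruxes.TwohalfdThesis.SketchIdeator1

open Literature.Analysis.FunctionSpaces Literature.Analysis.FunctionSpaces.Torus
open Literature.Analysis.FluidPDE Literature.Analysis.FluidPDE.Torus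
open Summit.AnomalousDissipation.AnomalousDissipation.Theses.TwoAndHalfD

/-- The flat two-torus. -/
local notation "𝕋²" => UnitAddTorus (Fin 2)
/-- Planar velocity values. -/
local notation "E²" => EuclideanSpace ℝ (Fin 2)

/-! ## Card 1: ergodic-minimax collapse -/

/-- **One affine functional encodes both budgets.** If the flux `F` is bounded by `H √E`
(Cauchy–Schwarz: `(h,θ) ≤ ‖h‖ ‖θ‖ ≤ ‖h‖ √energy`) and the affine combination `F - c E` has the
floor `ε ≥ 0`, then the energy is capped by `(H/c)²` and the flux keeps the floor `ε`. -/
theorem affineBudget (H c ε F E : ℝ) (hc : 0 < c) (hE : 0 ≤ E) (hε : 0 ≤ ε)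
    (hF : F ≤ H * Real.sqrt E) (hfloor : ε ≤ F - c * E) : E ≤ (H / c) ^ 2 ∧ ε ≤ F := by
  have hcE : c * E ≤ H * Real.sqrt E := by linarith
  refine ⟨?_, by nlinarith⟩
  rcases eq_or_lt_of_le hE with hE0 | hEpos
  · rw [← hE0]; positivity
  · have hs : 0 < Real.sqrt E := Real.sqrt_pos.2 hEpos
    have hsq : Real.sqrt E * Real.sqrt E = E := Real.mul_self_sqrt hE
    -- `c √E ≤ H`
    have h1 : c * Real.sqrt E ≤ H := by
      have : c * Real.sqrt E * Real.sqrt E ≤ H * Real.sqrt E := by nlinarith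
      exact le_of_mul_le_mul_right this hs
    have hH : 0 ≤ H := le_trans (by positivity) h1
    have h2 : Real.sqrt E ≤ H / c := by
      rw [le_div_iff₀ hc]; linarith [mul_comm c (Real.sqrt E)]
    calc E = Real.sqrt E ^ 2 := by rw [sq, hsq]
      _ ≤ (H / c) ^ 2 := by
        exact pow_le_pow_left₀ hs.le h2 2

/-- **LIMIT WITNESSES (generic points).** The `x₃`-invariant zeroth law stated with classical global
planar solutions `(v_j, p_j)` of 2-D Navier–Stokes forced by `g`, classical steadily sourced scalars
`θ_j` (source `h`, Prandtl number one), and honest Cesàro LIMITS of the total energy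
`∫‖v_j‖² + ∫θ_j²` (≤ `E`) and of the total dissipation `ν_j(‖∇v_j‖² + ‖∇θ_j‖²)` (≥ `ε`): the output
format of the Birkhoff ergodic theorem applied to an ergodic invariant measure of the coupled
semiflow at fixed `ν_j`. -/
def LimitWitness2halfD : Prop :=
  ∃ (g : 𝕋² → E²) (h : 𝕋² → ℝ), IsSmooth g ∧ IsDivFree g ∧ HasZeroMean g ∧ IsSmooth h ∧
    HasZeroMean h ∧
    ∃ (ν : ℕ → ℝ) (v : ℕ → ℝ → 𝕋² → E²) (p : ℕ → ℝ → 𝕋² → ℝ) (θ : ℕ → ℝ → 𝕋² → ℝ) (E ε : ℝ),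
      (∀ j, 0 < ν j) ∧ Tendsto ν atTop (𝓝 0) ∧ 0 < ε ∧
      (∀ j, IsClassicalNSSolutionOn (Ici 0) (ν j) (fun _ => g) (v j) (p j)) ∧
      (∀ j, IsClassicalScalarTransportForcedOn (Ici 0) (ν j) (v j) (fun _ => h) (θ j)) ∧
      ∀ j, ∃ Ebar D : ℝ, Ebar ≤ E ∧ ε ≤ D ∧
        Tendsto (timeMean fun t => (∫ x, ‖v j t x‖ ^ 2) + scalarL2Sq (θ j t)) atTop (𝓝 Ebar) ∧
        Tendsto (timeMean fun t => ν j * (gradNormSq (v j t) + scalarGradNormSq (θ j t))) atTop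
          (𝓝 D)

/-- **Lift of limit witnesses** (glue, provable now on paper): `twoHalf (v_j t) (θ_j t)` is a
classical, hence global Leray–Hopf, `x₃`-invariant solution of NS forced by `twoHalf g h`
(`isClassicalNSSolutionOn_twoHalf` with the scalar residual equal to `h`,
`IsClassicalNSSolutionOn.isGlobalLerayHopf`, `twoHalf_add_single`); Cesàro limits are `limsup`s
(`longTimeAvgSup`), and `meanDissipation` agrees with the classical dissipation
(`gradNormSq_eq_toReal_eGradNormSq`, `scalarGradNormSq_eq_toReal`, spectral split of `twoHalf`). -/
def LimitWitnessLift : Prop :=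
  LimitWitness2halfD → TwohalfdThesis

/-- **FINITE-HORIZON SUP FORM.** For ONE affine observable
`φ_c(v,θ) = (h, θ) - c (‖v‖² + ‖θ‖²)` and every horizon `T`, SOME classical trajectory of the coupled
system at viscosity `ν_j` (datum free, chosen per `T`) has window average `≥ ε'`.  By ergodic
optimisation (max over invariant measures of `∫φ` = `inf_T sup_x` of window averages, Fekete
subadditivity + Krylov–Bogoliubov) this is equivalent to the existence of an invariant measure with
`∫φ_c ≥ ε'`, i.e. (by `affineBudget` and the stationary balance `ν∫‖∇θ‖² dμ = ∫(h,θ) dμ`) to the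
ensemble zeroth law in the class, i.e. (Birkhoff, generic points) to `LimitWitness2halfD`. -/
def FiniteHorizonSup2halfD : Prop :=
  ∃ (g : 𝕋² → E²) (h : 𝕋² → ℝ), IsSmooth g ∧ IsDivFree g ∧ HasZeroMean g ∧ IsSmooth h ∧
    HasZeroMean h ∧
    ∃ (c ε' : ℝ) (ν : ℕ → ℝ), 0 < c ∧ 0 < ε' ∧ (∀ j, 0 < ν j) ∧ Tendsto ν atTop (𝓝 0) ∧
      ∀ j, ∀ T : ℝ, 0 < T →
        ∃ (v : ℝ → 𝕋² → E²) (p : ℝ → 𝕋² → ℝ) (θ : ℝ → 𝕋² → ℝ),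
          IsClassicalNSSolutionOn (Ici 0) (ν j) (fun _ => g) v p ∧
          IsClassicalScalarTransportForcedOn (Ici 0) (ν j) v (fun _ => h) θ ∧
          ε' ≤ timeMean (fun t => (∫ x, h x * θ t x) -
                  c * ((∫ x, ‖v t x‖ ^ 2) + scalarL2Sq (θ t))) T

/-- **TRANSFER (the deep direction)**: finite-horizon sup form ⇒ the crux.  Paper route:
Krylov–Bogoliubov on the empirical measures of the window trajectories (tight: `φ_c ≥ ε'` on
average forces bounded mean energy, parabolic smoothing gives compactness one time unit later),
upper semicontinuity of `φ_c`, `affineBudget` + ergodic decomposition + Chebyshev for ONE good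
ergodic component, Birkhoff for a generic smooth datum (`LimitWitness2halfD`), then
`LimitWitnessLift`. -/
def FiniteHorizonTransfer : Prop :=
  FiniteHorizonSup2halfD → TwohalfdThesis

/-- **The converse** (so the transfer is an EQUIVALENCE, not a strengthening): descend an
`X`-witness to `(v_j, w_j)` (Fubini; 2-D energy equality), restart at `t = 1` (2-D smoothing at
fixed `ν_j > 0`), use the scalar energy identity to trade mean dissipation for mean flux, and take
`c = ε/(2E)`: the witness's own windows along a sequence `T_k → ∞` have `φ_c`-average `≥ ε/2 - o(1)`,
and Fekete subadditivity of `T ↦ sup_x S_T φ_c` upgrades "along a sequence" to "for every `T`". -/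
def FiniteHorizonOfThesis : Prop :=
  TwohalfdThesis → FiniteHorizonSup2halfD

/-! ## Card 2: autocatalytic debris / torque-age law -/

/-- Planar curl `∂₀w₁ - ∂₁w₀` of a vector field on `T²` (the vorticity when `w` is a velocity, the
torque density when `w = g` is the force). -/
def planarCurl (w : 𝕋² → E²) (x : 𝕋²) : ℝ :=
  (partialDeriv 0 w x) 1 - (partialDeriv 1 w x) 0

/-- **Pr = 1: the vorticity is a steadily sourced scalar in its own flow.** For a classical planar
Navier–Stokes solution forced by a steady smooth `g`, `ω = planarCurl v` solves
`∂ₜω + v·∇ω = νΔω + planarCurl g` classically on the same time set (curl of the momentum equation: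
`curl ∇p = 0`, `curl((v·∇)v) = v·∇ω` when `div v = 0`, `curl Δ = Δ curl`). -/
def VorticityIsSourcedScalar : Prop :=
  ∀ (S : Set ℝ) (ν : ℝ) (g : 𝕋² → E²) (v : ℝ → 𝕋² → E²) (p : ℝ → 𝕋² → ℝ),
    UniqueDiffOn ℝ S → IsSmooth g → IsClassicalNSSolutionOn S ν (fun _ => g) v p →
      IsClassicalScalarTransportForcedOn S ν v (fun _ => planarCurl g) fun t => planarCurl (v t)

/-- **Parabolic maximum principle with source** for classical sourced scalars on the torus:
`‖θ(t)‖_∞ ≤ ‖θ(0)‖_∞ + t ‖s‖_∞` on `[0, T]` (at an interior maximum of `θ - (M + (S₀+δ)t)` the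
equation gives a contradiction; let `δ → 0`). -/
def SourcedScalarMaxPrinciple : Prop :=
  ∀ (T κ : ℝ) (u : ℝ → 𝕋² → E²) (s θ : ℝ → 𝕋² → ℝ) (M S₀ : ℝ), 0 ≤ κ →
    IsClassicalScalarTransportForcedOn (Icc 0 T) κ u s θ →
      (∀ x, |θ 0 x| ≤ M) → (∀ t ∈ Icc 0 T, ∀ x, |s t x| ≤ S₀) →
        ∀ t ∈ Icc 0 T, ∀ x, |θ t x| ≤ M + t * S₀

/-- **TORQUE-AGE LAW** (corollary of the two statements above): in steadily forced planar
Navier–Stokes the vorticity a fluid element carries is at most its initial vorticity plus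
`‖planarCurl g‖_∞ ×` its age.  Intensity `Ω` therefore needs torque-coherence time `≥ Ω/‖curl g‖_∞`:
the engine of the island census and of the bootstrap gap of card `autocatalytic-debris-seeding`. -/
def TorqueAgeLaw : Prop :=
  ∀ (T ν : ℝ) (g : 𝕋² → E²) (v : ℝ → 𝕋² → E²) (p : ℝ → 𝕋² → ℝ) (M G : ℝ), 0 ≤ ν → 0 < T →
    IsSmooth g → IsClassicalNSSolutionOn (Icc 0 T) ν (fun _ => g) v p →
      (∀ x, |planarCurl (v 0) x| ≤ M) → (∀ x, |planarCurl g x| ≤ G) →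
        ∀ t ∈ Icc 0 T, ∀ x, |planarCurl (v t) x| ≤ M + t * G

/-- The torque-age law follows from the two named statements (bookkeeping check). -/
theorem torqueAgeLaw_of (h1 : VorticityIsSourcedScalar) (h2 : SourcedScalarMaxPrinciple) :
    TorqueAgeLaw := by
  intro T ν g v p M G hν hT hg hns h0 hG t ht x
  have hsrc := h1 (Icc 0 T) ν g v p (uniqueDiffOn_Icc hT) hg hns
  exact h2 T ν v (fun _ => planarCurl g) (fun t => planarCurl (v t)) M G hν hsrc h0
    (fun t _ x => hG x) t ht x

end Summit.AnomalousDissipation.AnomalousDissipation.Cruxes.TwohalfdThesis.SketchIdeator1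

end
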